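import Literature.NumberTheory.DiophantineGeometry.MordellCoprimeSolutionsHeightBoundProofs
import Literature.NumberTheory.LFunctions.PrimeNumberTheoremProgressions
import HarnessLib

/-!
# von Känel–Matschke, Corollary 7.4 (the greatest prime factor of `y² − x³`) from Corollary 7.3 and the
# prime number theorem (proofs)

Topic `Literature/NumberTheory/DiophantineGeometry` (family `abc`). A proofs-only companion (theorems only; NO
definition, NO new named fact; D-0014, D-0026) of `MordellThueRamanujanNagellHeightBounds.lean`, where
**Corollary 7.4** (`cor:coates2`) of R. von Känel, B. Matschke, arXiv:1605.06079 = Mem. AMS 286 (2023), no. 1419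
[`VonkanelMatschke2023`] is typed as the named fact `corollary_7_4`: *"For any real number `ε > 0` there is an
effective constant `c(ε)` … Suppose that `x` and `y` are coprime rational integers, and write
`X = max(|x|,|y|)`. Then the greatest rational prime factor of `y² − x³` exceeds `(1 − ε) log log X + c(ε)`"*
(the typed statement drops the word "effective").

## The printed proof (§7.1) and how it is followed

*"Let `S` be the set of rational primes dividing `a = y² − x³` and write `q = max(S)`. The explicit version of the
prime number theorem given in [Rosser–Schoenfeld] shows that `log N_S ≤ ∑_{p ≤ q} log p ≤ q(1 + 1/(2 log q))`.
Thus Corollary 7.3 implies Corollary 7.4."* We follow this with ONE deviation: the explicit Rosser–Schoenfeld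
bound is not in the tree, so the step `∑_{p ≤ q} log p = θ(q) ≤ (1 + δ)q` (`q ≥ q₀(δ)`) is taken from the
tree's prime number theorem `Literature.NumberTheory.LFunctions.chebyshevTheta_sub_self_isLittleO`
(`θ(x) = x + o(x)`, Wiener–Ikehara); this yields the printed shape `(1 − ε) log log X + c(ε)` with an
ineffective `c(ε)`, which is exactly what the typed `corollary_7_4` asserts. In detail, for coprime `x, y` with
`a ≠ 0` and `S = {p ∣ a}`: `gcd(x, y, N_S) = 1`, `f = |a|`, `r₂(a) = 1`, `α_S = 1728 N_S`, so Corollary 7.3 gives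
`log X ≤ 2α log α + (3/4)α log₃α + 6α ≤ 3.75 α log α`; `log N_S ≤ θ(q)` (`log_primesProd_le_theta`); hence
`log log X ≤ (1 + δ)θ(q) + C₁(δ)` (`loglog_le_of_height_bound`), and `θ(q) ≤ (1 + δ)q` for `q ≥ q₀`,
`θ(q) ≤ q log 4` always (Mathlib `Chebyshev.theta_le_log4_mul_x`). For `a = 0` coprimality forces
`|x| = |y| = 1`.

## Main results

* `corollary_7_4_of_corollary_7_3 : corollary_7_3 → corollary_7_4`;
* `corollary_7_4_of_roots (hmod) (h104) (hi) : corollary_7_4` — from {modularity, Lemma 10.4, Prop. 10.8 (i)}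
  through `corollary_7_3_of_roots`.

No `abc` claim; axioms standard.
-/

noncomputable section

open Height Filter Asymptotics

namespace Literature.NumberTheory.DiophantineGeometry

namespace VonKanelMatschke

/-! ### Inputs from prime number theory -/

/-- **PNT in the form used**: `θ(q) ≤ (1 + δ)q` for `q ≥ q₀(δ)` (from the tree's `θ(x) = x + o(x)`).
[cite: VonkanelMatschke2023, §7.1 (proof of Cor. 7.4: "the prime number theorem … shows that log N_S ≤ ∑_{p≤q} log p ≤ …")] -/
theorem theta_le_of_pnt {δ : ℝ} (hδ : 0 < δ) :
    ∃ q₀ : ℕ, ∀ q : ℕ, q₀ ≤ q → Chebyshev.theta q ≤ (1 + δ) * q := by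
  have h := (Literature.NumberTheory.LFunctions.chebyshevTheta_sub_self_isLittleO.def hδ)
  rw [Filter.eventually_atTop] at h
  obtain ⟨q₀, hq₀⟩ := h
  refine ⟨q₀, fun q hq => ?_⟩
  have h1 := hq₀ q hq
  have hq' : (0 : ℝ) ≤ q := Nat.cast_nonneg q
  rw [Real.norm_eq_abs, Real.norm_eq_abs, abs_of_nonneg hq'] at h1
  have := (abs_le.mp h1).2
  linarith

/-- `log N_S ≤ ∑_{p ≤ q} log p = θ(q)` for a finite set of primes `S` with `q = max(S)` (`N_S ∣ q#`).
[cite: VonkanelMatschke2023, §7.1 (proof of Cor. 7.4)] -/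
theorem log_primesProd_le_theta {S : Finset ℕ} (hS : ∀ p ∈ S, p.Prime) :
    Real.log (primesProd S) ≤ Chebyshev.theta ((S.sup id : ℕ) : ℝ) := by
  have hsub : S ⊆ (Finset.range (S.sup id + 1)).filter Nat.Prime := fun p hp =>
    Finset.mem_filter.mpr ⟨Finset.mem_range.mpr (Nat.lt_succ_of_le (Finset.le_sup (f := id) hp)), hS p hp⟩
  have hdvd : primesProd S ∣ primorial (S.sup id) := by
    rw [primesProd, primorial]; exact Finset.prod_dvd_prod_of_subset _ _ _ hsub
  have hle : (primesProd S : ℝ) ≤ primorial (S.sup id) := by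
    exact_mod_cast Nat.le_of_dvd (primorial_pos _) hdvd
  rw [Chebyshev.theta_eq_log_primorial, Nat.floor_natCast]
  exact Real.log_le_log (by exact_mod_cast one_le_primesProd hS) hle

/-! ### `S = {p ∣ a}`: `f = |a|`, `r₂(a) = 1`, `α_S = 1728 N_S` -/

/-- For `S` the set of primes dividing `a ≠ 0`: `f = |a|`. [cite: VonkanelMatschke2023, §7.1 (f; proof of Cor. 7.4)] -/
theorem sPart_primeFactors_self {a : ℤ} (ha : a ≠ 0) : sPart a.natAbs.primeFactors a = a.natAbs := by
  have hn : a.natAbs ≠ 0 := Int.natAbs_ne_zero.mpr ha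
  rw [sPart]
  conv_rhs => rw [← Nat.prod_factorization_pow_eq_self hn]
  rw [Finsupp.prod, Nat.support_factorization]
  exact Finset.prod_congr rfl fun p hp => by
    rw [Nat.factorization_def _ (Nat.prime_of_mem_primeFactors hp)]

/-- For `S` the set of primes dividing `a`: `r₂(a) = 1`, so `α_S = 1728 N_S`.
[cite: VonkanelMatschke2023, §7.1 (α_S = 1728 N_S r₂(a); proof of Cor. 7.4)] -/
theorem alphaLevel_primeFactors (a : ℤ) :
    alphaLevel a.natAbs.primeFactors (a : ℚ) = 1728 * primesProd a.natAbs.primeFactors := by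
  rw [alphaLevel, coprimePartTrunc, Rat.num_intCast, Finset.sdiff_self, Finset.prod_empty, mul_one]

/-! ### Real-analysis helpers -/

/-- `log log n ≥ −1/2` for every natural number `n` (`log log 0 = log log 1 = 0`, `log log 2 ≈ −0.37`). [folklore] -/
private theorem neg_half_le_loglog_natCast (n : ℕ) : -(1 / 2 : ℝ) ≤ Real.log (Real.log n) := by
  have he := Real.exp_one_lt_d9
  have he' := Real.exp_one_gt_d9
  have hl2 := Real.log_two_gt_d9
  rcases Nat.lt_or_ge n 3 with h | h
  · interval_cases n
    · norm_num
    · norm_num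
    · push_cast
      rw [Real.le_log_iff_exp_le (by linarith)]
      have hsq : Real.exp (1 / 2) ^ 2 = Real.exp 1 := by rw [← Real.exp_nat_mul]; norm_num
      have hpos : 0 < Real.exp (1 / 2 : ℝ) := Real.exp_pos _
      have h164 : 1.64 ≤ Real.exp (1 / 2 : ℝ) := by nlinarith
      rw [Real.exp_neg]
      calc (Real.exp (1 / 2))⁻¹ ≤ (1.64 : ℝ)⁻¹ := inv_anti₀ (by norm_num) h164
        _ ≤ Real.log 2 := by
          have : (1.64 : ℝ)⁻¹ ≤ 0.61 := by norm_num
          linarith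
  · have hn : (3 : ℝ) ≤ n := by exact_mod_cast h
    have h1 : 1 < Real.log n := by
      rw [Real.lt_log_iff_exp_lt (by linarith)]; linarith
    have := Real.log_pos h1
    linarith

/-- `log 1728 ≤ 7.63`. [folklore] -/
private theorem log_1728_le'' : Real.log 1728 ≤ 7.63 := by
  have hl2 := Real.log_two_lt_d9
  have h1 : Real.log (1728 : ℝ) ≤ Real.log 2048 := Real.log_le_log (by norm_num) (by norm_num)
  rw [show (2048 : ℝ) = 2 ^ 11 by norm_num, Real.log_pow] at h1
  push_cast at h1; linarith

/-- `log 1728 ≥ 7.43`. [folklore] -/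
private theorem log_1728_ge'' : (7.43 : ℝ) ≤ Real.log 1728 := by
  have hl2 := Real.log_two_gt_d9
  have he := Real.exp_one_lt_d9
  have h1 : Real.log 1728 = 10 * Real.log 2 + Real.log 1.6875 := by
    rw [show (1728 : ℝ) = 2 ^ 10 * 1.6875 by norm_num, Real.log_mul (by norm_num) (by norm_num),
      Real.log_pow]; push_cast; ring
  have h2 : (1 / 2 : ℝ) ≤ Real.log 1.6875 := by
    rw [Real.le_log_iff_exp_le (by norm_num)]
    have hsq : Real.exp (1 / 2) ^ 2 = Real.exp 1 := by rw [← Real.exp_nat_mul]; norm_num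
    have hpos : 0 < Real.exp (1 / 2 : ℝ) := Real.exp_pos _
    nlinarith
  rw [h1]; linarith

/-- **The analytic step** `log log X ≤ (1 + δ)θ + C₁(δ)`: if `0 ≤ log X ≤ 2α log α + (3/4)α log₃α + 6α` with
`α ≥ 1728` and `log α ≤ 7.63 + T` (`T ≥ 0`), then for `δ > 0`,
`log log X ≤ (1 + δ)T + (log 3.75 + 7.63 − log δ + 7.63 δ)` (`log₃ α ≤ log α`, `6 ≤ log α`,
`log log α ≤ log(7.63 + T) ≤ −log δ + δ(7.63 + T) − 1`). [folklore] -/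
private theorem loglog_le_of_height_bound {lX α T δ : ℝ} (hlX0 : 0 ≤ lX)
    (hlX : lX ≤ 2 * α * Real.log α + 3 / 4 * α * Real.log (Real.log (Real.log α)) + 6 * α)
    (hα : 1728 ≤ α) (hT : 0 ≤ T) (hlogα : Real.log α ≤ 7.63 + T) (hδ : 0 < δ) :
    Real.log lX ≤ (1 + δ) * T + (Real.log 3.75 + 7.63 - Real.log δ + 7.63 * δ) := by
  have hα0 : 0 < α := by linarith
  have hlogα1 : 7.43 ≤ Real.log α := log_1728_ge''.trans (Real.log_le_log (by norm_num) hα)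
  have hlogα0 : 0 < Real.log α := by linarith
  have hll : Real.log (Real.log α) ≤ Real.log α - 1 := Real.log_le_sub_one_of_pos hlogα0
  have hll0 : 0 < Real.log (Real.log α) := Real.log_pos (by linarith)
  have hl3 : Real.log (Real.log (Real.log α)) ≤ Real.log (Real.log α) - 1 :=
    Real.log_le_sub_one_of_pos hll0
  have p1 : α * Real.log (Real.log (Real.log α)) ≤ α * Real.log α :=
    mul_le_mul_of_nonneg_left (by linarith) hα0.le
  have p2 : α * 6 ≤ α * Real.log α := mul_le_mul_of_nonneg_left (by linarith) hα0.le
  have hG : lX ≤ 3.75 * α * Real.log α := by linarith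
  have hG1 : 1 < 3.75 * α * Real.log α := by
    have := mul_le_mul hα hlogα1 (by norm_num) hα0.le
    linarith
  have h1 : Real.log lX ≤ Real.log (3.75 * α * Real.log α) := by
    rcases eq_or_lt_of_le hlX0 with h0 | hpos
    · rw [← h0, Real.log_zero]; exact (Real.log_pos hG1).le
    · exact Real.log_le_log hpos hG
  have h2 : Real.log (3.75 * α * Real.log α) = Real.log 3.75 + Real.log α + Real.log (Real.log α) := by
    rw [Real.log_mul (by positivity) hlogα0.ne', Real.log_mul (by norm_num) hα0.ne']
  have h3 : Real.log (Real.log α) ≤ Real.log (7.63 + T) := Real.log_le_log hlogα0 hlogα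
  have h4 : Real.log (7.63 + T) ≤ -Real.log δ + δ * (7.63 + T) - 1 := by
    have hu : 0 < 7.63 + T := by linarith
    have h5 : Real.log (δ * (7.63 + T)) ≤ δ * (7.63 + T) - 1 :=
      Real.log_le_sub_one_of_pos (by positivity)
    rw [Real.log_mul hδ.ne' hu.ne'] at h5
    linarith
  linarith

/-! ### Corollary 7.4 -/

/-- **vKM Corollary 7.4 ⟸ Corollary 7.3** (PROVED, following the printed proof of §7.1 with `S = {p ∣ a}`,
`q = max(S)`, `log N_S ≤ θ(q)`; the bound `θ(q) ≤ (1 + δ)q` for large `q` is the tree's prime number theorem in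
place of the printed explicit Rosser–Schoenfeld inequality, so the constant `c(ε)` obtained here is not
effective — the typed statement does not claim effectivity). For `a = y² − x³ = 0` coprimality forces
`|x| = |y| = 1`. [cite: VonkanelMatschke2023, Cor. 7.4 (arXiv §7.1, cor:coates2) and its proof] -/
theorem corollary_7_4_of_corollary_7_3 (h73 : corollary_7_3) : corollary_7_4 := by
  intro ε hε
  classical
  set δ : ℝ := min ε 1 / 4 with hδdef
  have hmin0 : 0 < min ε 1 := lt_min hε one_pos
  have hδ0 : 0 < δ := by rw [hδdef]; positivity
  have hδ1 : δ ≤ 1 / 4 := by rw [hδdef]; linarith [min_le_right ε 1]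
  have h2δ : 2 * δ ≤ ε := by rw [hδdef]; linarith [min_le_left ε 1]
  obtain ⟨q₀, hq₀⟩ := theta_le_of_pnt hδ0
  set C₁ : ℝ := Real.log 3.75 + 7.63 - Real.log δ + 7.63 * δ with hC₁def
  have hC₁0 : 0 ≤ C₁ := by
    have h1 : Real.log δ ≤ 0 := Real.log_nonpos hδ0.le (by linarith)
    have h2 : 0 ≤ Real.log (3.75 : ℝ) := Real.log_nonneg (by norm_num)
    rw [hC₁def]; nlinarith
  have hl4 : 0 ≤ Real.log (4 : ℝ) := Real.log_nonneg (by norm_num)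
  set C₂ : ℝ := (1 + δ) * (Real.log 4 * q₀) + C₁ with hC₂def
  have hC₂0 : 0 ≤ C₂ := by rw [hC₂def]; positivity
  refine ⟨-(C₁ + C₂ + ε + 1), fun x y hcop => ?_⟩
  set a : ℤ := y ^ 2 - x ^ 3 with hadef
  set L : ℝ := Real.log (Real.log ((max |x| |y| : ℤ) : ℝ)) with hLdef
  -- `X = max(|x|,|y|) ∈ ℕ`, `log X ≥ 0`, `log log X ≥ −1/2`
  have hX0 : (0 : ℤ) ≤ max |x| |y| := (abs_nonneg x).trans (le_max_left _ _)
  obtain ⟨n, hn⟩ := Int.eq_ofNat_of_zero_le hX0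
  have hlX0 : 0 ≤ Real.log ((max |x| |y| : ℤ) : ℝ) := by
    rw [hn, Int.cast_natCast]
    rcases Nat.eq_zero_or_pos n with h0 | hpos
    · simp [h0]
    · exact Real.log_nonneg (by exact_mod_cast hpos)
  have hL0 : -(1 / 2 : ℝ) ≤ L := by
    rw [hLdef, hn, Int.cast_natCast]; exact neg_half_le_loglog_natCast n
  -- `(1 − ε) log log X ≤ (1 − 2δ) log log X + ε/2`
  have hred : (1 - ε) * L ≤ (1 - 2 * δ) * L + ε / 2 := by
    by_cases hL : 0 ≤ L
    · have h := mul_nonneg (sub_nonneg.mpr h2δ) hL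
      linarith
    · push Not at hL
      have h := mul_le_mul_of_nonneg_left (show -L ≤ 1 / 2 by linarith) (sub_nonneg.mpr h2δ)
      linarith
  by_cases ha : a = 0
  · -- `y² = x³` with `x, y` coprime: `|x| = |y| = 1`, `X = 1`, no prime factor
    have hx3 : y ^ 2 = x ^ 3 := by have : y ^ 2 - x ^ 3 = 0 := ha; linarith
    have hux : IsUnit x :=
      (hcop.pow_right (n := 2)).isUnit_of_dvd' (dvd_refl x) ⟨x ^ 2, by rw [hx3]; ring⟩
    have huy : IsUnit y :=
      (hcop.pow_left (m := 3)).isUnit_of_dvd' ⟨y, by rw [← hx3]; ring⟩ (dvd_refl y)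
    have hx1 : |x| = 1 := by rcases Int.isUnit_iff.mp hux with rfl | rfl <;> norm_num
    have hy1 : |y| = 1 := by rcases Int.isUnit_iff.mp huy with rfl | rfl <;> norm_num
    have hL1 : L = 0 := by rw [hLdef, hx1, hy1, max_self]; simp
    have hq : a.natAbs.primeFactors.sup id = 0 := by rw [ha]; simp
    rw [hq, hL1]; push_cast; linarith
  · -- `a ≠ 0`: `S = {p ∣ a}`, `q = max S`, Corollary 7.3 with `gcd(x, y, N_S) = 1`
    set S : Finset ℕ := a.natAbs.primeFactors with hSdef
    have hS : ∀ p ∈ S, p.Prime := fun p hp => Nat.prime_of_mem_primeFactors hp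
    set q : ℕ := S.sup id with hqdef
    have hg : Int.gcd x y = 1 := Int.isCoprime_iff_gcd_eq_one.mp hcop
    have hgcd : Int.gcd (Int.gcd x y : ℤ) (primesProd S) = 1 := by rw [hg]; simp
    have h := h73 S hS a ha x y hadef.symm hgcd
    have hf : sPart S a = a.natAbs := sPart_primeFactors_self ha
    have hαN : alphaLevel S (a : ℚ) = 1728 * primesProd S := alphaLevel_primeFactors a
    have haR : (a.natAbs : ℝ) ≠ 0 := by exact_mod_cast Int.natAbs_ne_zero.mpr ha
    rw [hf, div_self haR, Real.log_one, mul_zero, zero_add, hαN] at h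
    -- `α_S = 1728 N_S ≥ 1728`, `log α_S ≤ 7.63 + θ(q)`
    have hN1 := one_le_primesProd hS
    have hα1728 : (1728 : ℝ) ≤ ((1728 * primesProd S : ℕ) : ℝ) := by
      exact_mod_cast Nat.le_mul_of_pos_right _ hN1
    have hT0 : 0 ≤ Chebyshev.theta q := Chebyshev.theta_nonneg _
    have hlogα : Real.log ((1728 * primesProd S : ℕ) : ℝ) ≤ 7.63 + Chebyshev.theta q := by
      have hN0 : (0 : ℝ) < primesProd S := by exact_mod_cast hN1
      rw [Nat.cast_mul, Nat.cast_ofNat, Real.log_mul (by norm_num) hN0.ne']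
      have := log_primesProd_le_theta hS
      linarith [log_1728_le'']
    have KEY : L ≤ (1 + δ) * Chebyshev.theta q + C₁ :=
      loglog_le_of_height_bound hlX0 h hα1728 hT0 hlogα hδ0
    have hT1 : Chebyshev.theta q ≤ Real.log 4 * q := Chebyshev.theta_le_log4_mul_x (Nat.cast_nonneg q)
    have hq0 : (0 : ℝ) ≤ q := Nat.cast_nonneg q
    by_cases hq : q₀ ≤ q
    · -- `θ(q) ≤ (1 + δ) q`: `(1 − 2δ) log log X ≤ q + C₁`
      have hT := hq₀ q hq
      have hmain : (1 - 2 * δ) * L ≤ q + C₁ := by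
        by_cases hL : 0 ≤ L
        · have h1 : (1 + δ) * Chebyshev.theta q ≤ (1 + δ) * ((1 + δ) * q) :=
            mul_le_mul_of_nonneg_left hT (by linarith)
          have h2 : L ≤ (1 + δ) ^ 2 * q + C₁ := by nlinarith
          have h3 : (1 - 2 * δ) * L ≤ (1 - 2 * δ) * ((1 + δ) ^ 2 * q + C₁) :=
            mul_le_mul_of_nonneg_left h2 (by linarith)
          have e : (1 - 2 * δ) * ((1 + δ) ^ 2 * q + C₁) =
              q + C₁ - (2 * δ * C₁ + (3 * δ ^ 2 + 2 * δ ^ 3) * q) := by ring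
          have h4 : 0 ≤ 2 * δ * C₁ + (3 * δ ^ 2 + 2 * δ ^ 3) * q := by positivity
          linarith
        · push Not at hL
          have := mul_nonpos_of_nonneg_of_nonpos (show (0 : ℝ) ≤ 1 - 2 * δ by linarith) hL.le
          linarith
      linarith
    · -- `q < q₀`: `log log X ≤ C₂`
      push Not at hq
      have hq' : (q : ℝ) ≤ q₀ := by exact_mod_cast hq.le
      have hTq : Chebyshev.theta q ≤ Real.log 4 * q₀ := hT1.trans (mul_le_mul_of_nonneg_left hq' hl4)
      have hLC : L ≤ C₂ := by
        have : (1 + δ) * Chebyshev.theta q ≤ (1 + δ) * (Real.log 4 * q₀) :=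
          mul_le_mul_of_nonneg_left hTq (by linarith)
        rw [hC₂def]; linarith
      have hmain : (1 - 2 * δ) * L ≤ C₂ := by
        by_cases hL : 0 ≤ L
        · have : (1 - 2 * δ) * L ≤ 1 * L := mul_le_mul_of_nonneg_right (by linarith) hL
          linarith
        · push Not at hL
          have := mul_nonpos_of_nonneg_of_nonpos (show (0 : ℝ) ≤ 1 - 2 * δ by linarith) hL.le
          linarith
      linarith

/-- **vKM Corollary 7.4 ⟸ {modularity, Lemma 10.4, Prop. 10.8 (i)}** (through `corollary_7_3_of_roots` and the
tree's prime number theorem). [cite: VonkanelMatschke2023, Cor. 7.4 (arXiv §7.1, cor:coates2)] -/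
theorem corollary_7_4_of_roots
    (hmod : Literature.NumberTheory.EllipticCurves.ModularForms.nonempty_modularParametrizationData)
    (h104 : Literature.NumberTheory.EllipticCurves.ModularForms.vonKanelMatschke_lemma_10_4)
    (hi : Literature.NumberTheory.EllipticCurves.ModularForms.vonKanelMatschke_prop_10_8_i) :
    corollary_7_4 :=
  corollary_7_4_of_corollary_7_3 (corollary_7_3_of_roots hmod h104 hi)

end VonKanelMatschke

end Literature.NumberTheory.DiophantineGeometry

end
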